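import Summits.ResolutionOfSingularities.ResolutionOfSingularities.Theorems.MarkedTransferCampaignW46ThreefoldsNoNearPointSlice
import HarnessLib

/-!
# [OURS · L1 W4.6 rung (ii-τ)] THE NO-NEAR-POINT SLICE OF THE HOST ITEM — stmt-16156's conclusion shape
# (`IsMarkedResolution ⟨J, E, m⟩`) for an equimultiple regular centre carrying the order-`m` locus, made of `τ = 3`
# threefold points and `τ ≥ 2` curve points, having simple normal crossings with the boundary `E`, PROVED

Cell res-hironaka, LADDER-RESOLUTION rung L (D-0089), slot W4.6, rung (ii) (threefold hypersurfaces); seat res-L1-s46-pv-3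
(gen 3). Host route MarkedTransfer, host item `HypersurfaceOrderReductionDimLeThree` (stmt-ResolutionOfSingularities-16156);
filed `--kind proof --supports` it `--as helper`. OURS scheme theory over PROVED tree lemmas (Cossart–Piltant 2008
Lemma 4.3 (1)+(2), kernel-checked in the tree); nothing of H. Hironaka's manuscript is asserted. AI-written; AI review is
weaker than expert review. Host-shape twin of `…ThreefoldsNoNearPointSlice.lean` (p510009).

## What is proved (no new definitions)

* `CampaignW46.exists_isMarkedResolution_of_noNearPoints` — `X` regular locally Noetherian, `E` a boundary, `J`, `m ≥ 1`,
  `Y ⊆ X` closed with `V(𝓘_Y)` regular, `𝓘_Y` having simple normal crossings with `E` (`HasSNCWith E 𝓘_Y` — the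
  B-permissibility of the centre, an HYPOTHESIS here), `Y ⊇ {ord ≥ m}`, `ord = m` on `Y`, and at each point of `Y` either
  a threefold point with `(𝓘_Y)_y = 𝔪_y` and `τ = 3` or a codimension-`2` curve point with `τ ≥ 2`: then `(X, J, E, m)`
  has a BGMW marked resolution — the single blowing up along `𝓘_Y`, with EMPTY final support.

HONEST VALUE. Completes the host-shape side of the no-near-point slices (the finite-point case, where B-permissibility is
automatic, is `…HostTauThreeSlice.lean`); for curve centres the normal-crossings condition with `E` is assumed, not proved.

References: `…ThreefoldsNoNearPointSlice.lean` (p510009), tree `Resolution/NearPointsPointCentre.lean`,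
`Resolution/NearPointsCurveCentre.lean` [CossartPiltant2008, Lemma 4.3], `Resolution/MarkedIdeals.lean`
(`IsMultipleBlowup.single` [BierstoneGrigorievMilmanWlodarczyk2011, Def. 3.1.3]). H. Hironaka, ms. 2017-03-23 — scope
only, under adjudication, not cited as fact. [Hironaka2017]
-/

noncomputable section

set_option linter.dupNamespace false -- mandated namespace of this single-conjunct summit

open CategoryTheory AlgebraicGeometry TopologicalSpace IsLocalRing

namespace Summit.ResolutionOfSingularities.ResolutionOfSingularities.Theorems

namespace CampaignW46

open Literature.AlgebraicGeometry.Resolution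
open Scheme.IdealSheafData

universe u

variable {X : Scheme.{u}}

/-- **THE NO-NEAR-POINT SLICE, HOST SHAPE** (see the module docstring). [cite: CossartPiltant2008, Lemma 4.3] -/
theorem exists_isMarkedResolution_of_noNearPoints [IsLocallyNoetherian X] (hX : Scheme.IsRegular X)
    (J : X.IdealSheafData) (E : List X.IdealSheafData) {m : ℕ} (hm : 1 ≤ m) (Y : Closeds X)
    (hreg : Scheme.IsRegular (vanishingIdeal Y).subscheme) (hsnc : HasSNCWith E (vanishingIdeal Y))
    (hJY : ∀ x : X, (m : ℕ∞) ≤ idealOrder J x → x ∈ (Y : Set X)) (hord : ∀ y ∈ (Y : Set X), idealOrder J y = m)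
    (hτ : ∀ y ∈ (Y : Set X), haveI := hX y;
      ((maximalIdeal (X.presheaf.stalk y)).spanFinrank = 3 ∧
          stalkIdeal (vanishingIdeal Y) y = maximalIdeal (X.presheaf.stalk y) ∧ stalkTau J y m = 3) ∨
        (∃ c : Fin 2 → X.presheaf.stalk y, IsRsopPart c ∧
          Ideal.span (Set.range c) = stalkIdeal (vanishingIdeal Y) y ∧ 2 ≤ stalkTau J y m)) :
    ∃ (X' : Scheme.{u}) (Φ : X' ⟶ X) (M' : MarkedIdeal X'), IsMarkedResolution (⟨J, E, m⟩ : MarkedIdeal X) Φ M' := by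
  have hsupp : ((vanishingIdeal Y).support : Set X) ⊆ (⟨J, E, m⟩ : MarkedIdeal X).support := by
    intro y hy
    rw [coe_support_vanishingIdeal] at hy
    exact (hord y hy).ge
  obtain ⟨X', π, hπ⟩ := exists_isBlowup X (vanishingIdeal Y)
  haveI : IsProper π := hπ.isProper
  haveI : IsLocallyNoetherian X' := LocallyOfFiniteType.isLocallyNoetherian π
  refine ⟨X', π, (⟨J, E, m⟩ : MarkedIdeal X).transform π (vanishingIdeal Y),
    IsMultipleBlowup.single _ _ π hπ hreg hsupp hsnc, ?_⟩
  ext x'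
  simp only [Set.mem_empty_iff_false, iff_false]
  change ¬ ((m : ℕ∞) ≤ idealOrder (controlledTransform π (vanishingIdeal Y) J m) x')
  rw [not_le]
  by_cases hmem : π x' ∈ ((vanishingIdeal Y).support : Set X)
  · rw [coe_support_vanishingIdeal] at hmem
    haveI := hX (π x')
    rcases hτ (π x') hmem with ⟨hd, hstalk, hτ3⟩ | ⟨c, hcr, hcY, hτ2⟩
    · obtain ⟨c₀, hc₀⟩ := exists_regularSystemOfParameters (R := X.presheaf.stalk (π x'))
      let c : Fin 3 → X.presheaf.stalk (π x') := fun i => c₀ (i.cast hd.symm)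
      have hrange : Set.range c = Set.range c₀ := by
        ext a
        constructor
        · rintro ⟨i, rfl⟩; exact ⟨i.cast hd.symm, rfl⟩
        · rintro ⟨i, rfl⟩; exact ⟨i.cast hd, by simp [c]⟩
      have hc : Ideal.span (Set.range c) = maximalIdeal _ := by rw [hrange, hc₀]
      have hcY : Ideal.span (Set.range c) = stalkIdeal (vanishingIdeal Y) (π x') := by rw [hc, hstalk]
      exact hπ.idealOrder_controlledTransform_lt_of_stalkTau_eq_three hX hreg hord hd hc hcY hτ3
    · exact hπ.idealOrder_controlledTransform_lt_of_two_le_stalkTau hX hreg hm hord hcr hcY hτ2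
  · rw [hπ.idealOrder_controlledTransform_of_not_mem J m hmem]
    by_contra hge
    rw [not_lt] at hge
    apply hmem
    rw [coe_support_vanishingIdeal]
    exact hJY _ hge

end CampaignW46

end Summit.ResolutionOfSingularities.ResolutionOfSingularities.Theorems

end
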